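import Mathlib.CategoryTheory.SingleObj
import Mathlib.GroupTheory.Perm.Fin
import Literature.AlgebraicGeometry.Frobenioids.BaseSectionsOfObjects
import Literature.AlgebraicGeometry.Frobenioids.ModelFrobenioidWalkingArrowSlim
import Literature.AlgebraicGeometry.Frobenioids.ModelFrobenioidBiratNormalized
import Literature.AlgebraicGeometry.Frobenioids.ModelFrobenioidBaseSectionSkeleton
import Literature.AlgebraicGeometry.Frobenioids.BiratLocalization
import Literature.AnabelianGeometry.EtaleTheta.MonoprimeStructure
import HarnessLib

/-!
# Frobenioids I, Corollary 5.7 (i), "`C₁` is of model type iff `C₂` is": the typed `Cor57i_model` is a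
# SCHEMA in free birationalization data — its universal closure is FALSE (junk datum), while the model-type
# clause holds at THE birationalization of the witness

Mochizuki, *The geometry of Frobenioids I: the general theory*, Kyushu J. Math. **62** (2008)
293–400, Cor. 5.7 (i) p. 108: "In particular, `C₁` is of model type if and only if `C₂` is", with "model
type" = pre-model type (Def. 2.7 (iii) p. 52) and birationally Frobenius-normalized type (Def. 4.5 (i) p. 86:
"the image of `A` in `C^birat` is Frobenius-normalized") [cite: MochizukiFrdI2008, Cor. 5.7 (i) p.108]
[cite: MochizukiFrdI2008, Def. 4.5 (i) p.86]; Thm. 5.2 (ii) p. 101 (model Frobenioids are of model type)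
[cite: MochizukiFrdI2008, Thm. 5.2 (ii) p.101].

PROOF-ONLY file (abc-iut cell, F fact-proving wave, seat abc-iut-f-022; FACT-LIST row F-0935
`PreFrobenioid.Cor57i_model`, rule R5 "a universal closure of a schema row is not a fact"). The typed
statement `PreFrobenioid.Cor57i_model F₁ F₂ Ψ B₁ B₂` (seat abc-iut-L1-t5, `BaseSectionsOfObjects.lean`)
renders "model type" of `C_i` as `IsOfPreModelType F_i ∧ IsOfBiratFrobeniusNormalizedType B_i` over FREE
birationalization data `B_i : BiratData` — a data-only interface (`DivisorMonoidCategoryTheoreticityDefs.lean`,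
seat abc-iut-L1-t3) that is faithful to print only when instantiated with THE birationalization
`PreFrobenioid.biratData` (`BirationalizationBiratData.lean`, rulings C5′/C5‴). This file records, kernel-checked:

* `PreFrobenioidData.exists_biratData_not_isOfBiratFrobeniusNormalizedType` — over ANY pre-Frobenioid data
  `S` on a category with an object, the interface `S.BiratData` has an inhabitant that is NOT of birationally
  Frobenius-normalized type (the "twist by `S₃`" datum: `C^birat := C × B S₃` with the zero divisor monoid and
  all Frobenius degrees `1`; two non-commuting permutations are base-identity linear endomorphisms violating
  `α^{deg φ} ∘ φ = φ ∘ α`). So the Def. 4.5 (i) conjunct of `Cor57i_model` cannot hold for all `B₂`.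
* `ConstNatModel.cor57Hypotheses_walkingArrow_refl`, `…isOfPreModelType_walkingArrow`,
  `…isOfBiratFrobeniusNormalizedType_walkingArrow` — a GENUINE instance of all antecedents: the model Frobenioid
  of the constant monoid `(ℕ, +)` over the walking arrow `Fin 2` (seat abc-iut-w4-d088,
  `ModelFrobenioidWalkingArrow*.lean`) satisfies the standing hypotheses `Cor57Hypotheses` of Cor. 5.7 at
  `Ψ = 𝟭` (Frobenioid, `Φ ≡ ℕ` perf-factorial, `Fin 2` slim hence Div-slim, standard type), is of pre-model
  type and — Thm. 5.2 (ii), seat abc-iut-L1-d10's `ModelFrobenioid.isOfBiratFrobeniusNormalizedType_of_isDivisorial`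
  — of birationally Frobenius-normalized type AT THE birationalization; hence
* `ConstNatModel.cor57i_model_walkingArrow_biratData` — the typed `Cor57i_model` HOLDS at this instance with
  `B₁ = B₂ =` THE birationalization (instance form, model-witnessed), and
* `ConstNatModel.not_cor57i_model_walkingArrow_twist`, `PreFrobenioid.not_forall_cor57i_model` — it FAILS
  with `B₂` the twist datum: **the universal closure of the typed `Cor57i_model` is false.** The faithful
  reading (both `B_i` THE birationalizations, arbitrary `Ψ`) is untouched by this and is NOT asserted here; its
  pre-model conjunct is `PreFrobenioid.isOfPreModelType_iff_of_facts` (seat abc-iut-L1-d6).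

No new definition (every datum is built inside a proof); no statement of the paper is restated or
strengthened; nothing here bears on, or takes a side on, [IUTchIII] Cor. 3.12.
-/

namespace Literature.AlgebraicGeometry.Frobenioids

open CategoryTheory Opposite

universe w v v' u u'

/-! ### §1 The birationalization-data interface admits non-Frobenius-normalized junk over any `S` -/

namespace PreFrobenioidData

variable {C : Type u} [Category.{v} C] {D : Type u'} [Category.{v'} D] (S : PreFrobenioidData.{w} C D)

/-- Two transpositions of `S₃ = Perm(Fin 3)` that do not commute. [folklore] -/
private theorem swap_mul_swap_ne :
    Equiv.swap (0 : Fin 3) 1 * Equiv.swap (1 : Fin 3) 2 ≠ Equiv.swap (1 : Fin 3) 2 * Equiv.swap (0 : Fin 3) 1 := by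
  decide

/-- **The interface `BiratData` is data-only**: over any pre-Frobenioid data `S` on a category `C` with an
object `A₀`, the "twist by `S₃`" datum — `C^birat := C × B S₃` (`B S₃` the one-object category of the
symmetric group `S₃`), `C → C^birat` the inclusion at the unit, base functor through the first projection, the
zero divisor monoid, all Frobenius degrees `1`, `Φ^birat := 0`, unit divisors `0` — is a legitimate
`S.BiratData` for which the object `A₀` is NOT birationally Frobenius-normalized (Def. 4.5 (i)): the
endomorphisms `(𝟙, (0 1))`, `(𝟙, (1 2))` of `A₀^birat` are base-identity and linear but do not commute. Hence
no statement quantifying over ALL `B : S.BiratData` with conclusion `IsOfBiratFrobeniusNormalizedType B` can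
hold; faithful instances use THE birationalization `PreFrobenioid.biratData`.
[cite: MochizukiFrdI2008, Def. 4.5 (i) p.86] -/
theorem exists_biratData_not_isOfBiratFrobeniusNormalizedType (A₀ : C) :
    ∃ B : BiratData.{w, v, v', u, u', v} S, ¬ IsOfBiratFrobeniusNormalizedType B := by
  classical
  let M := Equiv.Perm (Fin 3)
  let ι : C ⥤ C × SingleObj M := Functor.prod' (𝟭 C) ((Functor.const C).obj (SingleObj.star M))
  let ops : PreFrobenioidData.{w} (C × SingleObj M) D :=
    { base := CategoryTheory.Prod.fst C (SingleObj M) ⋙ S.base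
      Mon := fun _ => PUnit.{w + 1}
      pull := fun _ => MonoidHom.id _
      pull_id := fun _ _ => rfl
      pull_comp := fun _ _ _ => rfl
      div := fun _ => PUnit.unit
      degFr := fun _ => 1
      div_id := fun _ => rfl
      div_comp := fun _ _ => rfl
      degFr_id := fun _ => rfl
      degFr_comp := fun _ _ => (mul_one _).symm }
  let B : BiratData.{w, v, v', u, u', v} S :=
    { Birat := C × SingleObj M
      toBirat := ι
      obj_surjective := fun X => ⟨X.1, rfl⟩
      ops := ops
      ops_mon_eq_one := fun _ _ => rfl
      overBase := Iso.refl _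
      phiBirat := fun _ => ⊥
      divBirat := fun _ => 1
      divBirat_mem := fun _ _ => Subgroup.one_mem _ }
  refine ⟨B, fun h => ?_⟩
  -- the two non-commuting base-identity linear endomorphisms of `A₀^birat = (A₀, ⋆)`
  let σ : End (ι.obj A₀) := (𝟙 A₀, show SingleObj.star M ⟶ SingleObj.star M from Equiv.swap (0 : Fin 3) 1)
  let τ : End (ι.obj A₀) := (𝟙 A₀, show SingleObj.star M ⟶ SingleObj.star M from Equiv.swap (1 : Fin 3) 2)
  have hσ : ops.IsBaseIdentity σ := S.base.map_id A₀
  have hτ : τ ∈ ops.endSubmonoid (ι.obj A₀) := ⟨S.base.map_id A₀, rfl⟩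
  have key : τ ^ (1 : ℕ) * σ = σ * τ := h.obj A₀ σ hσ τ hτ
  rw [pow_one] at key
  -- `τ * σ = σ ≫ τ` has second component `(1 2) ∘ (0 1)`… compare second components
  exact swap_mul_swap_ne (congrArg Prod.snd key).symm

end PreFrobenioidData

/-! ### §2 The genuine instance: the model Frobenioid of `(ℕ, +)` over the walking arrow -/

namespace ConstNatModel

/-- The constant divisor monoid `(ℕ, +)` on any base is objectwise perf-factorial (`ℤ`-monoprime ⇒
perf-factorial, [FrdI] Def. 2.4 (i); abc-iut-L2's `MonoprimeStructure.isPerfFactorial`).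
[cite: MochizukiFrdI2008, Def. 2.4 (i) p.47] -/
theorem objectwise_isPerfFactorial_const (D : Type u) [Category.{v} D] :
    Objectwise (fun M _ => IsPerfFactorial M) ((Functor.const Dᵒᵖ).obj (CommMonCat.of DegreeModel.N)) :=
  fun _ => Literature.AnabelianGeometry.EtaleTheta.MonoprimeStructure.isPerfFactorial
    (IsMonoprime.ofZ ⟨⟨MulEquiv.refl _⟩⟩)

variable (DivB : zeroMonoid.{0} (Fin 2) ⟶ monoidGp ((Functor.const (Fin 2)ᵒᵖ).obj (CommMonCat.of DegreeModel.N)))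

/-- The walking arrow is Div-slim for the model Frobenioid of `(Fin 2, ℕ, 0, Div_B)` ("if `D` is slim, then it
is Div-slim", Def. 4.5 (iv) p. 86; `Fin 2` is slim, abc-iut-w4-d088's `isSlim_fin2`).
[cite: MochizukiFrdI2008, Def. 4.5 (iv) p.86] -/
theorem isDivSlim_walkingArrow : (ModelFrobenioid.data _ _ DivB).IsDivSlim :=
  (ModelFrobenioid.data _ _ DivB).isDivSlim_of_isSlim isSlim_fin2

/-- **The standing hypotheses of [FrdI] Cor. 5.7 HOLD (nonempty_genuine) for the model Frobenioid of
`(Fin 2, ℕ, 0, Div_B)` at `Ψ = 𝟭`**: a Frobenioid (Thm. 5.2 (ii)), `Φ ≡ ℕ` perf-factorial, `Fin 2` Div-slim,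
of standard type (Thm. 5.2 (iii)); the base-isomorphism clauses hold on the nose for `𝟭`.
[cite: MochizukiFrdI2008, Cor. 5.7 p.107] -/
theorem cor57Hypotheses_walkingArrow_refl :
    PreFrobenioid.Cor57Hypotheses (ModelFrobenioid.toElem _ _ DivB) (ModelFrobenioid.toElem _ _ DivB)
      (CategoryTheory.Equivalence.refl (C := ModelFrobenioid _ _ DivB)) where
  isFrobenioid₁ := isFrobenioid_walkingArrow DivB
  isFrobenioid₂ := isFrobenioid_walkingArrow DivB
  perfFactorial₁ := objectwise_isPerfFactorial_const (Fin 2)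
  perfFactorial₂ := objectwise_isPerfFactorial_const (Fin 2)
  divSlim₁ := isDivSlim_walkingArrow DivB
  divSlim₂ := isDivSlim_walkingArrow DivB
  standard₁ := isOfStandardType_walkingArrow DivB
  standard₂ := isOfStandardType_walkingArrow DivB
  baseIso_functor _ _ _ _ _ hf := hf
  baseIso_inverse _ _ _ _ _ hg := hg

/-- The model Frobenioid of `(Fin 2, ℕ, 0, Div_B)` is of pre-model type (Thm. 5.2 (ii), Def. 2.7 (iii);
abc-iut-found / abc-iut-L1-d10's `ModelFrobenioid.isOfPreModelType_of_isDivisorial`).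
[cite: MochizukiFrdI2008, Thm. 5.2 (ii) p.101] -/
theorem isOfPreModelType_walkingArrow : PreFrobenioid.IsOfPreModelType (ModelFrobenioid.toElem _ _ DivB) :=
  ModelFrobenioid.isOfPreModelType_of_isDivisorial (objectwise_isDivisorial_const (Fin 2))
    (hypotheses (Fin 2) isGraphConnected_fin2 isTotallyEpimorphic_fin2).isGroupLike_rat

/-- The model Frobenioid of `(Fin 2, ℕ, 0, Div_B)` is of birationally Frobenius-normalized type AT THE
birationalization `PreFrobenioid.biratData` (Thm. 5.2 (ii) "model — hence birationally Frobenius-normalized —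
type"; abc-iut-L1-d10's `ModelFrobenioid.isOfBiratFrobeniusNormalizedType_of_isDivisorial`).
[cite: MochizukiFrdI2008, Thm. 5.2 (ii) p.101] -/
theorem isOfBiratFrobeniusNormalizedType_walkingArrow :
    PreFrobenioidData.IsOfBiratFrobeniusNormalizedType
      (PreFrobenioid.biratData (isFrobenioid_walkingArrow DivB)
        (PreFrobenioid.hasBiratSquares_of_isFrobenioid (isFrobenioid_walkingArrow DivB))) :=
  ModelFrobenioid.isOfBiratFrobeniusNormalizedType_of_isDivisorial
    (hF := isFrobenioid_walkingArrow DivB)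
    (hsq := PreFrobenioid.hasBiratSquares_of_isFrobenioid (isFrobenioid_walkingArrow DivB))
    (hΦd := objectwise_isDivisorial_const (Fin 2))
    (hBg := (hypotheses (Fin 2) isGraphConnected_fin2 isTotallyEpimorphic_fin2).isGroupLike_rat)

/-- **[FrdI] Cor. 5.7 (i) "model type", instance form (model-witnessed)**: the typed `Cor57i_model` HOLDS for
the model Frobenioid of `(Fin 2, ℕ, 0, Div_B)`, `Ψ = 𝟭`, with `B₁ = B₂ =` THE birationalization.
[cite: MochizukiFrdI2008, Cor. 5.7 (i) p.108] -/
theorem cor57i_model_walkingArrow_biratData :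
    PreFrobenioid.Cor57i_model (ModelFrobenioid.toElem _ _ DivB) (ModelFrobenioid.toElem _ _ DivB)
      (CategoryTheory.Equivalence.refl (C := ModelFrobenioid _ _ DivB))
      (PreFrobenioid.biratData (isFrobenioid_walkingArrow DivB)
        (PreFrobenioid.hasBiratSquares_of_isFrobenioid (isFrobenioid_walkingArrow DivB)))
      (PreFrobenioid.biratData (isFrobenioid_walkingArrow DivB)
        (PreFrobenioid.hasBiratSquares_of_isFrobenioid (isFrobenioid_walkingArrow DivB))) :=
  fun _ => ⟨Iff.rfl, Iff.rfl⟩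

/-- **The typed `Cor57i_model` FAILS at a junk second datum**: for the model Frobenioid of
`(Fin 2, ℕ, 0, Div_B)` (all of `Cor57Hypotheses` at `Ψ = 𝟭`, pre-model type, birationally
Frobenius-normalized at THE birationalization `B₁`) there is a birationalization DATUM `B₂` of the same
Frobenioid with `¬ Cor57i_model F F 𝟭 B₁ B₂` — the twist datum of
`PreFrobenioidData.exists_biratData_not_isOfBiratFrobeniusNormalizedType`. [cite: MochizukiFrdI2008, Cor. 5.7 (i) p.108] -/
theorem exists_biratData_not_cor57i_model_walkingArrow :
    ∃ B₂ : PreFrobenioidData.BiratData.{0, 0, 0, 0, 0, 0} (ModelFrobenioid.data _ _ DivB),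
      ¬ PreFrobenioid.Cor57i_model (ModelFrobenioid.toElem _ _ DivB) (ModelFrobenioid.toElem _ _ DivB)
          (CategoryTheory.Equivalence.refl (C := ModelFrobenioid _ _ DivB))
          (PreFrobenioid.biratData (isFrobenioid_walkingArrow DivB)
            (PreFrobenioid.hasBiratSquares_of_isFrobenioid (isFrobenioid_walkingArrow DivB))) B₂ := by
  -- the object `(0, [0])` of the model Frobenioid (base the source of the walking arrow, class `0 ∈ ℤ = Φ^gp`)
  let A₀ : ModelFrobenioid _ _ DivB := ⟨0, 1⟩
  obtain ⟨B₂, hB₂⟩ :=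
    (ModelFrobenioid.data _ _ DivB).exists_biratData_not_isOfBiratFrobeniusNormalizedType A₀
  refine ⟨B₂, fun h => hB₂ ?_⟩
  exact ((h (cor57Hypotheses_walkingArrow_refl DivB)).2.mp
    ⟨isOfPreModelType_walkingArrow DivB, isOfBiratFrobeniusNormalizedType_walkingArrow DivB⟩).2

end ConstNatModel

/-! ### §3 The universal closure of the typed `Cor57i_model` is false -/

namespace PreFrobenioid

/-- **The universal closure of the typed [FrdI] Cor. 5.7 (i) "model type" statement `Cor57i_model` is FALSE**
(FACT-LIST row F-0935 is a SCHEMA over free birationalization data, rule R5): at the model Frobenioid of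
`(Fin 2, ℕ, 0, 0)` with `Ψ = 𝟭`, `B₁ =` THE birationalization and `B₂ =` the twist datum, the antecedent
`Cor57Hypotheses` holds and the Def. 4.5 (i) biconditional fails. The printed Cor. 5.7 (i) — both `B_i` THE
birationalizations — is not refuted by this. [cite: MochizukiFrdI2008, Cor. 5.7 (i) p.108] -/
theorem not_forall_cor57i_model :
    ¬ ∀ {D₁ : Type} [Category.{0} D₁] {Φ₁ : D₁ᵒᵖ ⥤ CommMonCat.{0}} {C₁ : Type} [Category.{0} C₁]
        (F₁ : C₁ ⥤ ElemFrobenioid Φ₁)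
        {D₂ : Type} [Category.{0} D₂] {Φ₂ : D₂ᵒᵖ ⥤ CommMonCat.{0}} {C₂ : Type} [Category.{0} C₂]
        (F₂ : C₂ ⥤ ElemFrobenioid Φ₂) (Ψ : C₁ ≌ C₂)
        (B₁ : PreFrobenioidData.BiratData.{0, 0, 0, 0, 0, 0} (PreFrobenioidData.ofFunctor Φ₁ F₁))
        (B₂ : PreFrobenioidData.BiratData.{0, 0, 0, 0, 0, 0} (PreFrobenioidData.ofFunctor Φ₂ F₂)),
        Cor57i_model F₁ F₂ Ψ B₁ B₂ := by
  intro h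
  let DivB : zeroMonoid.{0} (Fin 2) ⟶ monoidGp ((Functor.const (Fin 2)ᵒᵖ).obj (CommMonCat.of DegreeModel.N)) :=
    { app := fun _ => CommMonCat.ofHom 1
      naturality := fun X Y f => by
        apply CommMonCat.hom_ext
        apply MonoidHom.ext
        intro x
        change (1 : (zeroMonoid.{0} (Fin 2)).obj Y →* _) ((zeroMonoid.{0} (Fin 2)).map f x) =
          ((monoidGp ((Functor.const (Fin 2)ᵒᵖ).obj (CommMonCat.of DegreeModel.N))).map f).hom
            ((1 : (zeroMonoid.{0} (Fin 2)).obj X →* _) x)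
        rw [MonoidHom.one_apply, MonoidHom.one_apply, map_one] }
  obtain ⟨B₂, hB₂⟩ := ConstNatModel.exists_biratData_not_cor57i_model_walkingArrow DivB
  exact hB₂ (h _ _ _ _ B₂)

end PreFrobenioid

end Literature.AlgebraicGeometry.Frobenioids
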